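import Mathlib
import Summits.Ventures.HodgeRepro2.T5CompletionDegreeSum

/-!
# «`v` SPLITS COMPLETELY IN `L`», IN THREE READINGS, ON THE PLACES OF `L` (T5SplitsCompletelyPlaces)

For an extension of number fields `L/K` of ANY degree (no Galois hypothesis) and a finite place `v` of `K`, the
all-places sum `∑_{w ∣ v} e(w∣v) · f(w∣v) = [L : K]` (T5CompletionDegreeSum) identifies the three usual readings of
«`v` splits completely in `L`»: the COUNT reading (there are `[L : K]` places of `L` above `v`), the `(e, f)` reading
(`e(w∣v) = f(w∣v) = 1` at every place above `v`) and the COMPLETION reading (`[L_w : K_v] = 1` at every place above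
`v`) — `card_eq_finrank_iff`, `card_eq_finrank_iff_forall_eq_one`, `card_eq_finrank_iff_finrank`. This is the shape of the
standing hypothesis «`p` splits completely in `E`» of the route's datum (Tier-6 display `Hsieh2014mu_ThmA`, (S0)).

The finset of places is also tied to Mathlib's own objects: `card_primesOverFinset_eq : (primesOverFinset v.asIdeal
𝓞_L).card = S.card` and `ncard_primesOver_eq : (v.asIdeal.primesOver 𝓞_L).ncard = S.card`, so every count statement of
T5CompletionDegreeSum reads in either vocabulary.

Neighbouring files of other seats, not restated here: seat p7's `T5SplitsCompletely` (p391813: for a GALOIS `K/ℚ`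
or `E/F`, ONE prime of degree one forces `ncard (primesOver) = [K : ℚ]` — the propagation needs the Galois action;
here the equivalence is with «every place», no Galois action); seat p8's `T5LocalDegreeBounds` (p411633:
`[L_w : K_v] = 1 ↔ e = f = 1` at one place, `K_v → L_w` bijective at a split place) and `T5SplitPlaceLocalDegree`
(p412665: two distinct places above `v` in a quadratic `L/K` force both completions to be `K_v` — the converse of
`card_eq_two_of_finrank_eq_one` below).

No axiom beyond the standard trio; nothing of the scored record changes.
§8(d): uses an L-value-free non-vanishing device: NO.
-/

namespace Summit.Ventures.HodgeRepro2.T5SplitsCompletelyPlaces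

open IsDedekindDomain HeightOneSpectrum NumberField

variable {K : Type*} [Field K] [NumberField K] (v : HeightOneSpectrum (NumberField.RingOfIntegers K))
  {L : Type*} [Field L] [NumberField L] [Algebra K L]
  (S : Finset (HeightOneSpectrum (NumberField.RingOfIntegers L)))
  (hS : ∀ w : HeightOneSpectrum (NumberField.RingOfIntegers L), w ∈ S ↔ w.asIdeal.LiesOver v.asIdeal)

/-! ### The finset of places against Mathlib's `primesOverFinset` / `primesOver` -/

include hS in
/-- The number of places of `L` above `v` is the number of primes of `𝓞_L` over `v.asIdeal`. -/
theorem card_primesOverFinset_eq :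
    (IsDedekindDomain.primesOverFinset v.asIdeal (NumberField.RingOfIntegers L)).card = S.card := by
  classical
  rw [← Summit.Ventures.HodgeRepro2.T5CompletionDegreeSum.image_asIdeal_eq v S hS,
    Finset.card_image_of_injective _ fun w₁ w₂ h => HeightOneSpectrum.ext h]

include hS in
/-- The number of places of `L` above `v` is `(v.asIdeal.primesOver 𝓞_L).ncard`. -/
theorem ncard_primesOver_eq : (v.asIdeal.primesOver (NumberField.RingOfIntegers L)).ncard = S.card := by
  rw [← card_primesOverFinset_eq v S hS, ← Set.ncard_coe_finset,
    IsDedekindDomain.coe_primesOverFinset v.ne_bot]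

/-! ### «`v` splits completely» -/

include hS in
/-- THE COUNT READING ⟺ THE `e · f` READING: there are `[L : K]` places above `v` iff `e(w∣v) · f(w∣v) = 1` at every
place above `v`. -/
theorem card_eq_finrank_iff :
    S.card = Module.finrank K L ↔
      ∀ w ∈ S, v.asIdeal.ramificationIdx' w.asIdeal * v.asIdeal.inertiaDeg' w.asIdeal = 1 := by
  have hsum := Summit.Ventures.HodgeRepro2.T5CompletionDegreeSum.sum_ramificationIdx'_mul_inertiaDeg' v S hS
  have hone : ∀ w ∈ S, 1 ≤ v.asIdeal.ramificationIdx' w.asIdeal * v.asIdeal.inertiaDeg' w.asIdeal := by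
    intro w hw
    haveI := (hS w).1 hw
    exact Summit.Ventures.HodgeRepro2.T5CompletionDegreeSum.one_le_ramificationIdx'_mul_inertiaDeg' v w
  constructor
  · intro hcard
    -- a sum of `S.card` terms, each `≥ 1`, equal to `S.card`: every term is `1`
    rw [← hsum, Finset.card_eq_sum_ones] at hcard
    intro w hw
    have := (Finset.sum_eq_sum_iff_of_le hone).1 hcard w hw
    exact this.symm
  · intro hall
    rw [← hsum, Finset.sum_congr rfl hall, Finset.sum_const, smul_eq_mul, mul_one]

include hS in
/-- THE COUNT READING ⟺ THE `(e, f)` READING: there are `[L : K]` places above `v` iff `e(w∣v) = 1` and `f(w∣v) = 1`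
at every place above `v`. -/
theorem card_eq_finrank_iff_forall_eq_one :
    S.card = Module.finrank K L ↔
      ∀ w ∈ S, v.asIdeal.ramificationIdx' w.asIdeal = 1 ∧ v.asIdeal.inertiaDeg' w.asIdeal = 1 := by
  rw [card_eq_finrank_iff v S hS]
  exact forall₂_congr fun w _ => mul_eq_one

include hS in
/-- THE COUNT READING ⟺ THE COMPLETION READING: there are `[L : K]` places above `v` iff `[L_w : K_v] = 1` at every
place `w` above `v`. -/
theorem card_eq_finrank_iff_finrank :
    S.card = Module.finrank K L ↔
      ∀ (w : HeightOneSpectrum (NumberField.RingOfIntegers L)) [w.asIdeal.LiesOver v.asIdeal],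
        Module.finrank (v.adicCompletion K) (w.adicCompletion L) = 1 := by
  rw [card_eq_finrank_iff v S hS]
  constructor
  · intro hall w _
    rw [Summit.Ventures.HodgeRepro2.T5CompletionFundamentalIdentity.finrank_eq_ramificationIdx'_mul_inertiaDeg' v w]
    exact hall w ((hS w).2 inferInstance)
  · intro hall w hw
    haveI := (hS w).1 hw
    rw [← Summit.Ventures.HodgeRepro2.T5CompletionFundamentalIdentity.finrank_eq_ramificationIdx'_mul_inertiaDeg' v w]
    exact hall w

include hS in
/-- If `[L_w : K_v] = 1` at EVERY place `w` above `v` then there are `[L : K]` places above `v` (the `←` direction of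
`card_eq_finrank_iff_finrank`, stated for direct use). -/
theorem card_eq_finrank_of_forall_finrank_eq_one
    (hall : ∀ (w : HeightOneSpectrum (NumberField.RingOfIntegers L)) [w.asIdeal.LiesOver v.asIdeal],
      Module.finrank (v.adicCompletion K) (w.adicCompletion L) = 1) :
    S.card = Module.finrank K L :=
  (card_eq_finrank_iff_finrank v S hS).2 hall

include hS in
/-- In Mathlib's vocabulary: `v` splits completely iff `(primesOverFinset v.asIdeal 𝓞_L).card = [L : K]` iff
`e(w∣v) = f(w∣v) = 1` at every place above `v`. -/
theorem card_primesOverFinset_eq_finrank_iff :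
    (IsDedekindDomain.primesOverFinset v.asIdeal (NumberField.RingOfIntegers L)).card = Module.finrank K L ↔
      ∀ w ∈ S, v.asIdeal.ramificationIdx' w.asIdeal = 1 ∧ v.asIdeal.inertiaDeg' w.asIdeal = 1 := by
  rw [card_primesOverFinset_eq v S hS, card_eq_finrank_iff_forall_eq_one v S hS]

include hS in
/-- For a quadratic `L/K`: `[L_w : K_v] = 1` at ONE place `w` above `v` already means that `v` splits completely
(two places above `v`). -/
theorem card_eq_two_of_finrank_eq_one (hKL : Module.finrank K L = 2)
    (w : HeightOneSpectrum (NumberField.RingOfIntegers L)) [w.asIdeal.LiesOver v.asIdeal]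
    (h : Module.finrank (v.adicCompletion K) (w.adicCompletion L) = 1) : S.card = 2 := by
  rcases Summit.Ventures.HodgeRepro2.T5CompletionDegreeSum.card_eq_one_or_two v hKL S hS with h1 | h2
  · exfalso
    obtain ⟨w'', hw'', h2⟩ :=
      (Summit.Ventures.HodgeRepro2.T5CompletionDegreeSum.card_eq_one_iff_finrank v hKL S hS).1 h1
    have hww :=
      Summit.Ventures.HodgeRepro2.T5CompletionDegreeSum.unique_of_finrank_eq_two v hKL w'' h2 w inferInstance
    subst hww
    exact absurd (h.symm.trans h2) (by norm_num)
  · exact h2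

include hS in
/-- For a quadratic `L/K`: `v` splits completely (two places) iff `[L_w : K_v] = 1` at SOME place `w` above `v`. -/
theorem card_eq_two_iff_exists_finrank_eq_one (hKL : Module.finrank K L = 2) :
    S.card = 2 ↔ ∃ (w : HeightOneSpectrum (NumberField.RingOfIntegers L)) (_ : w.asIdeal.LiesOver v.asIdeal),
      Module.finrank (v.adicCompletion K) (w.adicCompletion L) = 1 := by
  constructor
  · intro hcard
    obtain ⟨w, hw⟩ := Summit.Ventures.HodgeRepro2.T5CompletionDegreeSum.nonempty v S hS
    haveI := (hS w).1 hw
    exact ⟨w, inferInstance,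
      (Summit.Ventures.HodgeRepro2.T5CompletionDegreeSum.card_eq_two_iff_finrank v hKL S hS).1 hcard w⟩
  · rintro ⟨w, hw, h⟩
    exact card_eq_two_of_finrank_eq_one v S hS hKL w h

end Summit.Ventures.HodgeRepro2.T5SplitsCompletelyPlaces
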